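import Summits.ResolutionOfSingularities.ResolutionOfSingularities.Theorems.WildPurityWildSymbolBirthDefs
import Summits.ResolutionOfSingularities.ResolutionOfSingularities.Theorems.WildPurityWildSymbolPeriodicTransport
import HarnessLib

/-!
# Crux `WildSymbol` (stmt-ResolutionOfSingularities-17133) — skeleton of line `birth` (lead c3 copy, cycle 4)

Route `ResolutionOfSingularities/WildPurity` (REFUTATION-shaped: `closes : WildSymbol → PurityTransfer →
¬ ResolutionOfSingularities`), crux #2 (rank 2, THE WITNESS, difficulty open-problem):
`WildSymbol` = "there are a prime `p`, a perfect field `k` of characteristic `p`, a finitely generated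
field `K/k`, a valuation ring `O ⊇ k` of `K`, an affine model `R ⊆ O` of `K` (finitely generated,
`Frac R = K`) and a class `α` of Kato's symbolic `H³_p(K) = G ⧸ N` which is `W`-integral at every
DIVISORIAL valuation ring `W ⊇ R` of `K/k` centred inside the centre of `O` — condition (D) — but is
NOT `O`-integral, `α ∉ Unr(O)` — condition (N)".

## The cut: PERIODIC TOWER (planner-skel, `Cruxes/WildSymbol/Lines/birth.lean`; lead's reshape, cycle 1)

Reshape w.r.t. the registered birth skeleton (sha 2dfca4aa…): the line's objects now live in the
LANDED definitions file `Theorems/WildPurityWildSymbolBirthDefs.lean` (p158459; `G`, `N`, `Unr`,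
`EssFiniteType`, `DivIntegral`, `locAt`, `tripleMap`, `PeriodicTower`, bodies verbatim, `N_eq : N p K =
‹route let›` by `rfl`, `wildSymbol_iff` by `Iff.rfl`), and the transport stub is the LANDED theorem
`stub_periodicTransport` (`Theorems/WildPurityWildSymbolPeriodicTransport.lean`, p159163). The only
`sorry` left is `stub_selfSimilarGerm`.

* `stub_periodicTransport` — **LANDED (p159163).** Along a periodic tower `(σ, O, S, α)` ((i) `σ⁻¹ S ⊆ S`,
  (ii) `O ⊆ ⋃ₙ σⁿ(S)`, (iii) `α` `σ`-invariant), `α ∉ Unr S → α ∉ Unr O`.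
* `stub_selfSimilarGerm` — **OPEN; load-bearing; the crux's difficulty.** There are `p, k, K, O, R`
  exactly as in the crux, a ring automorphism `σ` of `K` and a class `α` such that
  `(σ, O, locAt R O, α)` is a periodic tower, (D) holds, and `α ∉ Unr(locAt R O)`. With the transport
  it IMPLIES the crux (`WildSymbol_of`), so it is crux-sized by construction; any instance is, given
  `PurityTransfer`, a counterexample to resolution in characteristic `p` (trdeg `K ≥ 4`, `O` a
  non-Abhyankar place without local uniformization over `R`).
  CALIBRATION landed by the lead (where a germ can NOT live), all kernel-checked `--supports` files:
  - `Theorems/WildPurityWildSymbolBasinCalibration.lean` (p160726): the basin `T = ⋃ₙ σⁿ(S)` is a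
    `σ`-stable valuation ring `⊇ O` and `(σ, T, S, α)` is again a periodic tower (WLOG `O = T`); paper:
    `σ⁻¹` acts on `S` by a LOCAL homomorphism (dimension formula), so the levels are successive birational
    dominations of copies of one local ring; for `T` of rank one `v ∘ σ = λ v`, `λ ≤ 1`, `λ = 1 ⇔ T` discrete;
  - `Theorems/WildPurityWildSymbolArcPlaces.lean` (p159949): a DVR of `K` with PERFECT residue field
    absorbs all of `H³_p(K)` (`Unr = ⊤`) — no witness, and (BasinCalibration) no germ with such a basin:
    none at a CLOSED point with `λ = 1` (residue field of `T` = directed union of copies of the finite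
    extension `κ(S)/k`, perfect), none along a transcendental formal arc (the first non-Abhyankar basins
    that exist, e.g. `(x, y) ↦ (x/q, qy/x − 1)` on `k(x,y)`);
  - `Theorems/WildPurityWildSymbolPerfectHullDense.lean` (p161245): a rank-one `O` at which `K` is dense
    in its perfect hull (`K = Kᵖ + O`, `Kˣ = (Kˣ)ᵖ(1+𝔪_O)`) absorbs all of `H³_p(K)` — kills the
    independent-defect half of the `p`-divisible regime (Kuhlmann arXiv:1003.5639 §4.3);
  - `Theorems/WildPurityWildSymbolWeakTransport.lean` (p160854): (iii) may be weakened to invariance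
    MODULO `Unr S`; with `Theorems/WildPurityWildSymbolDivIntegralLocAt.lean` (p160983: (D) ⇔ integrality
    at every divisorial `W ⊇ S`) this turns the germ into the KANGAROO-MONODROMY certificate: `D(S) ≠ 0`
    and `ψ = Φ_{σ⁻¹} ∘ ι` not nilpotent on `D(S) = DivIntegral(S)/Unr S` (crux NOTES.md);
  - `Theorems/WildPurityWildSymbolCoarseningCalculus.lean`, `…ResidualAbsorption.lean`,
    `…ResidualAbsorptionCalibration.lean` (lead c2, cycle 3): DÉVISSAGE ALONG COARSENINGS — for valuation rings
    `O ≤ W` whose residual place `O/𝔪_W ⊆ κ(W)` absorbs the symbolic `H³_p(κ(W))`, `Unr O = Unr W`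
    (lift homomorphism `G_κ ⧸ N_κ → (G_K ⧸ N_K) ⧸ Unr O`); witnesses ASCEND to such coarsenings and none lives
    below a tested coarsening with absorbing residual place (e.g. divisor-then-closed-point / divisor-then-arc /
    divisor-then-dense-in-perfect-hull composites); WLOG a witness sits at its COARSEST non-integral level, where
    no residual place of a strictly coarser ring absorbs (`witness_at_coarsest_level`);
  - `Theorems/WildPurityWildSymbolNoLU.lean` (lead c3, cycle 4, p172256): the crux tied BY NAME to the open
    problem — a witness sits at a valuation ring WITHOUT `RelLocalUniformization` (mod `GrosSuwa1988_purity`), at a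
    rank-one place (mod `NovacoskiSpivakovsky2014`); `Theorems/WildPurityWildSymbolDimensionFour.lean` (cycle 4): the
    calibration "trdeg `K ≥ 4`" as a theorem (mod GS + `CossartPiltant2019LU3`, p173625) and `¬ LocalUniformizationUpToDim k d`
    for `d = dim R ≥ 4`; `Theorems/WildPurityWildSymbolNonAbhyankar.lean` (cycle 4, p173611): the witness place is NOT an
    Abhyankar place and trdeg `> 1`, mod GS ONLY (Knaf–Kuhlmann 2005 and curve LU are proved in the tree);
    `Cruxes/WildSymbol/Ideas/one-step-model.md` (cycle 4): the cocycle-level model of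
    `H^{q+1}_p(E(f^{1/p}))` over `E`, the step types (R)/(I)/(D) at a valuation and `Unr(O') = ⋃ Unr(O[y_N])` in the
    defect case — the handle for the first open slice SP₁ of sandwich purity;
  - hence a live germ needs: trdeg `K ≥ 4` (now a theorem mod GS + CP), a SINGULAR point reproducing itself under a
    contracting birational map, a NON-Abhyankar basin without relative LU (theorems mod GS), whose last sandwich step is
    of DEFECT type (D) — dependent-Artin–Schreier-defect type (`λ < 1`, rational rank 1) or rational rank `≥ 2` /
    imperfect residue field with NON-absorbing residual places.
* `WildSymbol_of : Sig.stub_selfSimilarGerm → Sig.stub_periodicTransport → WildSymbol` — PROVED (pure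
  logic over definitional unfolding); `WildSymbol_proof` plugs in the landed transport and the one open stub.

Disproof used: `Cruxes/WildSymbol/Disproof.lean` v3 (cdisprove cycle 1): its `_false_without_divisorial`
says every witness must use the divisorial restriction — the germ stub does (its (D) is verbatim); its
landed negatives (`Negative/LoadBearing.lean`, `Negative/HeightOneCentre.lean`) exclude `O = ⊤`, `O`
divisorial, `K/k` algebraic, height-one centre on a normal model — all consistent with the calibration
above (a basin `T` is never divisorial: it is not Noetherian unless `T = S`, excluded by (D) at `W := T`).
-/

noncomputable section

-- single-problem summit: the doubled namespace component `ResolutionOfSingularities` is forced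
set_option linter.dupNamespace false

namespace Summit.ResolutionOfSingularities.ResolutionOfSingularities.Theorems.WildSymbol.Birth

open Summit.ResolutionOfSingularities.ResolutionOfSingularities.Theses.WildPurity (WildSymbol)

/-! ## Sanity (proved): the local clause of the germ stub is the weak end of (N) -/

/-- `Unr` is monotone in the ring. [folklore] -/
theorem Unr_mono (p : ℕ) {K : Type} [Field K] {T T' : Subring K} (h : T ≤ T') :
    Unr p K T ≤ Unr p K T' :=
  AddSubgroup.closure_mono fun _ ⟨a, b, c, ha, hb, hb', hc, hc', hy⟩ =>
    ⟨a, b, c, h ha, h hb, h hb', h hc, h hc', hy⟩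

/-- The local ring of `R` at the centre of `O` lies inside `O` (when `R ⊆ O`). [folklore] -/
theorem locAt_le {K : Type} [Field K] {R : Set K} {O : ValuationSubring K} (hRO : R ⊆ O) :
    locAt R O ≤ O.toSubring := by
  refine Subring.closure_le.mpr ?_
  rintro x ⟨r, s, hr, hs, hsu, hx⟩
  have hsO : s ∈ O := hRO hs
  have hv : O.valuation s = 1 := by
    have h1 : O.valuation s ≤ 1 := (O.valuation_le_one_iff s).mpr hsO
    have h2 : ¬ O.valuation s < 1 := fun h => hsu ((O.mem_nonunits_iff (x := s)).mpr h)
    exact le_antisymm h1 (not_lt.mp h2)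
  have hs0 : s ≠ 0 := by
    rintro rfl
    simp at hv
  have hx' : x = r * s⁻¹ := by
    rw [← hx, mul_assoc, mul_inv_cancel₀ hs0, mul_one]
  show x ∈ O
  rw [hx']
  refine O.mul_mem _ _ (hRO hr) ?_
  rw [← O.valuation_le_one_iff, map_inv₀, hv, inv_one]

/-- Hence the crux's (N) `α ∉ Unr(O)` implies the germ stub's local clause `α ∉ Unr(locAt R O)`:
the clause is necessary, and what `stub_selfSimilarGerm` ADDS is the periodicity. [folklore] -/
theorem not_mem_Unr_locAt (p : ℕ) {K : Type} [Field K] {R : Set K} {O : ValuationSubring K}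
    (hRO : R ⊆ O) {α : G K ⧸ N p K} (hα : α ∉ Unr p K O.toSubring) : α ∉ Unr p K (locAt R O) :=
  fun h => hα (Unr_mono p (locAt_le hRO) h)

/-! ## The two stub STATEMENTS by name (`Sig.stub_<name>`; the composition takes exactly these) -/

/-- Statement of `stub_periodicTransport` (LANDED as `stub_periodicTransport`, p159163): along a
periodic tower, non-integrality at the bottom ring propagates to the exhausted valuation ring.
[cite: Kato1982, §1] -/
def Sig.stub_periodicTransport : Prop :=
  ∀ (p : ℕ) (K : Type) [Field K] (σ : K ≃+* K) (O : ValuationSubring K) (S : Subring K)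
    (α : G K ⧸ N p K), PeriodicTower p K σ O S α → α ∉ Unr p K S → α ∉ Unr p K O.toSubring

/-- The transport statement holds (the landed stub). [folklore] -/
theorem sig_stub_periodicTransport : Sig.stub_periodicTransport :=
  fun p K _ σ O S α hT hS => stub_periodicTransport p K σ O S α hT hS

/-- Statement of `stub_selfSimilarGerm`: a self-similar pointed candidate — the crux's datum
`(p, k, K, O, R)` with a ring automorphism `σ` of `K` and a class `α` forming a periodic tower over the
local ring `locAt R O` of the point, (D) holding, and `α` NOT integral at the point.
[cite: HauserPerlega2019, §1] -/
def Sig.stub_selfSimilarGerm : Prop :=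
  ∃ p : ℕ, p.Prime ∧ ∃ (k K : Type) (_ : Field k) (_ : CharP k p) (_ : PerfectField k) (_ : Field K)
    (_ : Algebra k K), (⊤ : IntermediateField k K).FG ∧ ∃ O : ValuationSubring K,
    (∀ c : k, algebraMap k K c ∈ O) ∧ ∃ R : Subalgebra k K, R.FG ∧ R.toSubring ≤ O.toSubring ∧
    IsFractionRing R K ∧ ∃ (σ : K ≃+* K) (α : G K ⧸ N p K),
      PeriodicTower p K σ O (locAt (R : Set K) O) α ∧ DivIntegral p k K R O α ∧
      α ∉ Unr p K (locAt (R : Set K) O)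

/-! ## The open stub -/

/-- **STUB (open; load-bearing): the self-similar wild germ exists.** See the module docstring
(why it might fail: resolution may hold; degree 3 may be blind to inseparable defect; the lead's
calibration: the basin must be a non-discrete or imperfect-residue valuation ring, trdeg `K ≥ 4`).
[cite: HauserPerlega2019, §1] -/
theorem stub_selfSimilarGerm : Sig.stub_selfSimilarGerm := by
  sorry

/-! ## The composition (kernel-checked; no `sorry` in its own term) -/

/-- **`WildSymbol` from the two stub statements** — the assembly, PROVED: unpack the self-similar
germ `(p, k, K, O, R, σ, α)`, obtain (N) `α ∉ Unr(O)` from the periodic transport applied at the local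
ring `S := locAt R O` of the point, and repack the crux's datum `(p, k, K, O, R, α)` with (D) carried
verbatim (the route's `let`s `G`, `N`, `Unr` unfold definitionally to the named ones).
[cite: Kato1982, §1] -/
theorem WildSymbol_of : Sig.stub_selfSimilarGerm → Sig.stub_periodicTransport → WildSymbol := by
  rintro ⟨p, hp, k, K, ik, icp, ipf, iK, ialg, hfg, O, hO, R, hR, hRO, hfr, σ, α, htower, hdiv, hloc⟩
    htrans
  exact ⟨p, hp, k, K, ik, icp, ipf, iK, ialg, hfg, O, hO, R, hR, hRO, hfr, α, hdiv,
    htrans p K σ O (locAt (R : Set K) O) α htower hloc⟩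

/-- **The crux `WildSymbol`, assembled** (the skeleton in its final shape: `WildSymbol_of` with the
landed transport and the one open stub plugged in; the only `sorry` in its closure is
`stub_selfSimilarGerm`). -/
theorem WildSymbol_proof : WildSymbol :=
  WildSymbol_of stub_selfSimilarGerm sig_stub_periodicTransport

end Summit.ResolutionOfSingularities.ResolutionOfSingularities.Theorems.WildSymbol.Birth

end
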